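import Literature.MathematicalPhysics.QuantumFieldTheory.Balaban1983to89.T4HistoryLipschitzEntropy

/-!
# T4HistoryLipschitzCubeGeometry (v1) — the support-map geometry of the NE9 activity binder CONSTRUCTED for finite cube
families: polymers = connected families of big cubes, incompatibility = a common or adjacent cube, clusters = families
with union `X`, pin = one cube of `X`

Trunk: ConstructiveQFT / Bałaban 1983–89, T⁴ output-rate estimate NE9 (coupling-history Lipschitz continuity with fading
memory, `T4OutputRate.NE9`), lineage NE9-P2 (inductive route).  Rung (B)+1 on a FIXED FINITE T⁴ — not infinite volume, not a
mass gap, not the Clay problem.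

WHAT THIS LEAF DOES.  The sibling leaves reduce NE9 ∧ FadingMemory (kernel) to the recursion-side binders of
`T4HistoryLipschitzRecursion` / `…Outer`, an activity binder whose only displayed analytic input is the DECAY of a
configuration-free majorant in the number of cubes of a polymer (`T4HistoryLipschitzEntropy` §6, hypothesis (A)), two scalar
smallness conditions (C), and — hypothesis (B) — the GEOMETRY: a `ClusterGeom` (polymers, incompatibility, step volumes,
localizing families, pins; `T4HistoryLipschitzActivity` §1) together with a support map `Supported` (v1.2, touch form), the
cover condition of `decayExtract_of_cover` and the pin-size / comparability conditions of `pinBudget_of_pinSize`.  Here (B) is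
CONSTRUCTED, not assumed, from a CUBE CHART of the carriers (`CubeChart`: each domain `X` has a nonempty finite set of cubes
`cubes X` inside a finite `region X` of a site type `α` (in `Type`, as the polymer field of `ClusterGeom`) with a symmetric adjacency of degree
`≤ D`, and the carrier's decay
length satisfies `d(X) ≤ #cubes X`):
* polymers = finite families of cubes; the step volume of `X` = the CONNECTED nonempty families inside `region X`
  (`connFamilies`; [I] p.257 «Such a domain is a union of a connected, finite family of cubes from π_j. A connected family
  means that for every pair □, □′ of cubes from the family there exists a sequence □, □₁, …, □ₙ, □′ of cubes belonging to
  the family and such that two consecutive cubes have a common wall», with `adj` ⊇ wall adjacency);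
* incompatibility `CubeInc`: equal, or a cube of one equal OR ADJACENT to a cube of the other ([II] (2.11) p.14 «ζ(Z, Z′) = 0
  if Z ∩ Z′ contains a cube, or a wall of a cube, and ζ(Z, Z′) = 1 otherwise»);
* localizing families of `X` = families of polymers of the volume whose union is `cubes X` ([II] (2.13) p.14: the sum
  defining `𝐄^{(k+1)}(X)` runs over clusters `(Z_1, …, Z_n)` with `∪ Z_i = X`);
* pin of `X` = the one-cube polymer `{c_X}`, `c_X ∈ cubes X` (touched by every localizing family, since some member contains
  `c_X`);
and the geometry binders are PROVED: `Supported` with `supp = id` (fields `sub`, `conn`, `inj`, `touch`, `deg`), the cover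
condition with `n X = #cubes X` (equality), pin size `1`, and the comparability `κ·d(X) ≤ d₁·#cubes X` for `0 ≤ κ ≤ d₁` from
the chart's `d(X) ≤ #cubes X` — the TYPE of the upper half of the PRINTED [II] (2.30) p.18 «(3·2³)⁻¹M⁻⁴|Y| ≤ d_k(Y) ≤
M⁻⁴|Y| − 1», «holding for localization domains Y ∈ 𝐃_k» (`M⁻⁴|Y|` = the number of big cubes of `Y`).  §5 composes with
`T4HistoryLipschitzEntropy` §6 and `T4HistoryLipschitzActivity` §8c: NE9 ∧ FadingMemory for averaged exp-evaluation activities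
on a cube chart, with hypothesis (B) GONE from the displayed list (`CubeChart.ne9_and_fadingMemory_of_decay`).  §6: the
intended site type at one scale — the discrete torus `Fin ν → ZMod N` with the ±unit-vector (wall) adjacency, symmetric of
degree `≤ 2ν` (`= 8` on T⁴) — and a chart over it (non-vacuity of `CubeChart`).

CONSISTENCY OF THE READING (arithmetic only, no claim about the manuscript): with size weights `d₁·#cubes`, the decay (A)
must beat `e^{a₁ + d₁ + Dθ}` per cube; the activity bound [II] Lemma 3 (2.38) p.20 decays at rate `(1 − 8δ)½Lκ` in
`d_{k+1}(Z)`, i.e. — through the lower half of (2.30), up to an additive constant — at a rate of order `Lκ` per cube, which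
exceeds `κ + a₁ + Dθ` for the large block size `L` of the manuscript; the uniformity of (A) over the tables of previous terms
remains NOT PRINTED (GAPS G-ne9p2-5 (i)) and is displayed, as are the recursion-side binders and the chart itself (DATA: which
cubes a domain index `X : C.Dom` denotes is not part of the abstract carriers).

ABSOLUTE RULE respected: nothing is cited as a fact; [I] = Bałaban CMP 109 (1987), [II] = Bałaban CMP 116 (1988) are quoted
for the TYPES of the constructed objects only, by page; everything is kernel-proved here or in the imported tree files.
HONEST SCOPE: a combinatorial construction discharging bookkeeping hypotheses; NOT an estimate, NOT summit progress.

References: [Balaban1987RG1] T. Bałaban, CMP 109 (1987), p.257 (localization domains, `d_j(X)`); [Balaban1988RG2Cluster]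
T. Bałaban, CMP 116 (1988), (2.11)–(2.13) p.14, (2.30) p.18, Lemma 3 (2.38) p.20, (2.39)–(2.41) p.21; [KoteckyPreiss1986]
R. Kotecký, D. Preiss, CMP 103 (1986), (1)–(3).
-/

noncomputable section

namespace Literature.MathematicalPhysics.QuantumFieldTheory.Balaban1983to89.T4HistoryLipschitzCubeGeometry

open scoped BigOperators
open Metric Set MeasureTheory
open Literature.Probability.LatticeModels
open Literature.MathematicalPhysics.QuantumFieldTheory.Balaban1983to89.T4OutputRate
open Literature.MathematicalPhysics.QuantumFieldTheory.Balaban1983to89.T4HistoryLipschitzRecursion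
open Literature.MathematicalPhysics.QuantumFieldTheory.Balaban1983to89.T4HistoryLipschitzOuter
open Literature.MathematicalPhysics.QuantumFieldTheory.Balaban1983to89.T4HistoryLipschitzActivity
open Literature.MathematicalPhysics.QuantumFieldTheory.Balaban1983to89.T4HistoryLipschitzEntropy
open Literature.MathematicalPhysics.QuantumFieldTheory.Balaban1983to89.T4HistoryLipschitzActivity (ClusterGeom)

/-! ## §1 The incompatibility of cube families: a common cube, or adjacent cubes -/

section Inc

variable {α : Type*} (adj : α → α → Prop)

/-- **INCOMPATIBILITY OF CUBE FAMILIES** `ζ(Y, Y′) = 0`: `Y = Y′`, or a cube of `Y` equal OR ADJACENT to a cube of `Y′` — the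
TYPE of [II] (2.11) p.14 «ζ(Z, Z′) = 0 if Z ∩ Z′ contains a cube, or a wall of a cube» with `adj` ⊇ wall adjacency (the
disjunct `Y = Y′` makes it reflexive also on the empty family, which is never a polymer).
[cite: Balaban1988RG2Cluster, (2.11) p.14] -/
def CubeInc (Y Y' : Finset α) : Prop := Y = Y' ∨ ∃ c ∈ Y, ∃ c' ∈ Y', c = c' ∨ adj c c'

/-- the incompatibility is decidable. [folklore] -/
instance instDecidableRelCubeInc [DecidableEq α] [DecidableRel adj] : DecidableRel (CubeInc adj) := fun Y Y' => by
  unfold CubeInc; infer_instance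

/-- the incompatibility is reflexive. [folklore] -/
theorem cubeInc_refl (Y : Finset α) : CubeInc adj Y Y := Or.inl rfl

variable {adj}

/-- the incompatibility is symmetric (for a symmetric adjacency). [folklore] -/
theorem cubeInc_symm [Std.Symm adj] {Y Y' : Finset α} (h : CubeInc adj Y Y') : CubeInc adj Y' Y := by
  rcases h with rfl | ⟨c, hc, c', hc', hcc'⟩
  · exact Or.inl rfl
  · refine Or.inr ⟨c', hc', c, hc, ?_⟩
    rcases hcc' with rfl | hadj
    · exact Or.inl rfl
    · exact Or.inr (Std.Symm.symm _ _ hadj)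

/-- families with a common cube are incompatible. [folklore] -/
theorem cubeInc_of_mem {Y Y' : Finset α} {c : α} (hc : c ∈ Y) (hc' : c ∈ Y') : CubeInc adj Y Y' :=
  Or.inr ⟨c, hc, c, hc', Or.inl rfl⟩

/-- **THE TOUCH CLAUSE** of `Supported` (v1.2) for the cube incompatibility: a nonempty family incompatible with `Y` has a
cube equal or adjacent to a cube of `Y`. [folklore] -/
theorem touch_of_cubeInc [Std.Symm adj] {Y Y' : Finset α} (hne : Y'.Nonempty) (h : CubeInc adj Y' Y) :
    ∃ x ∈ Y, ∃ x' ∈ Y', x' = x ∨ adj x x' := by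
  rcases h with rfl | ⟨c, hc, c', hc', hcc'⟩
  · obtain ⟨a, ha⟩ := hne
    exact ⟨a, ha, a, ha, Or.inl rfl⟩
  · refine ⟨c', hc', c, hc, ?_⟩
    rcases hcc' with rfl | hadj
    · exact Or.inl rfl
    · exact Or.inr (Std.Symm.symm _ _ hadj)

end Inc

/-! ## §2 Connected nonempty families of cubes inside a finite region -/

section Conn

variable {α : Type*} (adj : α → α → Prop)

open Classical in
/-- **THE LOCALIZATION DOMAINS OF A REGION**: the connected nonempty families of cubes inside the finite region `R` — the
TYPE of [I] p.257 («a union of a connected, finite family of cubes from π_j … two consecutive cubes have a common wall»), with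
connectedness = rooted reachability `Polymer.IsConn` of the tree for the adjacency `adj`. [cite: Balaban1987RG1, p.257] -/
def connFamilies (R : Finset α) : Finset (Finset α) :=
  R.powerset.filter fun Y => ∃ a ∈ Y, Polymer.IsConn adj Y a

variable {adj}

/-- membership in the localization domains of a region. [folklore] -/
theorem mem_connFamilies {R Y : Finset α} :
    Y ∈ connFamilies adj R ↔ Y ⊆ R ∧ ∃ a ∈ Y, Polymer.IsConn adj Y a := by
  classical
  simp only [connFamilies, Finset.mem_filter, Finset.mem_powerset]

/-- a localization domain of a region is nonempty. [folklore] -/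
theorem nonempty_of_mem_connFamilies {R Y : Finset α} (h : Y ∈ connFamilies adj R) : Y.Nonempty := by
  obtain ⟨-, a, ha, -⟩ := mem_connFamilies.1 h
  exact ⟨a, ha⟩

/-- a single cube of the region is a localization domain. [folklore] -/
theorem singleton_mem_connFamilies {R : Finset α} {c : α} (hc : c ∈ R) : {c} ∈ connFamilies adj R :=
  mem_connFamilies.2 ⟨Finset.singleton_subset_iff.2 hc, c, Finset.mem_singleton_self _,
    Polymer.isConn_singleton (adj := adj) c⟩

end Conn

/-! ## §3 The cube chart of the carriers and the CONSTRUCTED cluster geometry with its support map -/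

/-- **CUBE CHART (DATA + the printed comparability type)** of the carriers `C` into a site type `α` of cubes with an adjacency
`adj` of degree `≤ D`: every domain index `X` denotes a nonempty finite family of cubes `cubes X` inside the finite family
`region X` of all cubes of its scale, and the carrier's decay length is at most the number of cubes — the TYPE of the upper
half of [II] (2.30) p.18 «(3·2³)⁻¹M⁻⁴|Y| ≤ d_k(Y) ≤ M⁻⁴|Y| − 1».  Which cubes an index denotes is NOT part of the abstract
`Carriers`; it is supplied here. [cite: Balaban1988RG2Cluster, (2.30) p.18; Balaban1987RG1, p.257] -/
structure CubeChart (C : Carriers) (α : Type) [DecidableEq α] (adj : α → α → Prop) [DecidableRel adj] (D : ℕ) where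
  /-- the cubes of the domain `X` -/
  cubes : C.Dom → Finset α
  /-- all cubes of the scale of `X` -/
  region : C.Dom → Finset α
  cubes_sub : ∀ X, cubes X ⊆ region X
  cubes_nonempty : ∀ X, (cubes X).Nonempty
  /-- adjacency degree `≤ D` -/
  deg : ∀ (a : α) (Q : Finset α), (Q.filter (adj a)).card ≤ D
  /-- `d(X) ≤ #cubes X` -/
  d_le : ∀ X, C.d X ≤ ((cubes X).card : ℝ)

namespace CubeChart

variable {C : Carriers} {α : Type} [DecidableEq α] {adj : α → α → Prop} [DecidableRel adj] [Std.Symm adj] {D : ℕ}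
  (Γ : CubeChart C α adj D)

/-- the STEP VOLUME of `X`: the localization domains of its region. [folklore] -/
def vol (X : C.Dom) : Finset (Finset α) := connFamilies adj (Γ.region X)

open Classical in
/-- the LOCALIZING FAMILIES of `X`: families of polymers of the volume with union `cubes X` — the TYPE of the index set of
[II] (2.13) p.14 «𝐄^{(k+1)}(X) = Σ_{n=1}^{∞} (1/n!) Σ_{(Z_1,…,Z_n): ∪Z_i = X} ρ^T(Z_1,…,Z_n)H(Z_1)…H(Z_n)», «where X ∈ 𝐃_{k+1}»,
in the kernel shape of `ClusterGeom.clus` (finite SETS of distinct polymers, as the tree's `clusterSum`; the printed sum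
runs over ordered tuples). [cite: Balaban1988RG2Cluster, (2.13) p.14] -/
def clus (X : C.Dom) : Finset (Finset (Finset α)) :=
  (Γ.vol X).powerset.filter fun K => K.biUnion id = Γ.cubes X

/-- the pinned cube of `X` (a chosen cube of `X`). [folklore] -/
def pinCube (X : C.Dom) : α := (Γ.cubes_nonempty X).choose

omit [Std.Symm adj] in
/-- the pinned cube lies in `X`. [folklore] -/
theorem pinCube_mem (X : C.Dom) : Γ.pinCube X ∈ Γ.cubes X := (Γ.cubes_nonempty X).choose_spec

omit [Std.Symm adj] in
/-- membership in the step volume. [folklore] -/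
theorem mem_vol {X : C.Dom} {Y : Finset α} :
    Y ∈ Γ.vol X ↔ Y ⊆ Γ.region X ∧ ∃ a ∈ Y, Polymer.IsConn adj Y a := mem_connFamilies

omit [Std.Symm adj] in
/-- membership in the localizing families. [folklore] -/
theorem mem_clus {X : C.Dom} {K : Finset (Finset α)} :
    K ∈ Γ.clus X ↔ K ⊆ Γ.vol X ∧ K.biUnion id = Γ.cubes X := by
  classical
  simp only [clus, Finset.mem_filter, Finset.mem_powerset]

/-- **THE CONSTRUCTED CLUSTER GEOMETRY** of a cube chart: polymers = finite cube families, incompatibility `CubeInc`, step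
volume = localization domains of the region, localizing families = families with union `cubes X`, pin = `{pinCube X}`; the
three structural laws (`clus_sub`, `pin_mem`, `clus_pin`) are PROVED. [cite: Balaban1988RG2Cluster, (2.11)-(2.13) p.14] -/
def geom : ClusterGeom C where
  P := Finset α
  inc := CubeInc adj
  inc_refl := cubeInc_refl adj
  inc_symm := fun _ _ h => cubeInc_symm h
  vol := Γ.vol
  clus := Γ.clus
  clus_sub := fun _ _ hK => (Γ.mem_clus.1 hK).1
  pin := fun X => {Γ.pinCube X}
  pin_mem := fun X => singleton_mem_connFamilies (Γ.cubes_sub X (Γ.pinCube_mem X))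
  clus_pin := fun X K hK => by
    obtain ⟨-, hU⟩ := Γ.mem_clus.1 hK
    have hc : Γ.pinCube X ∈ K.biUnion id := by rw [hU]; exact Γ.pinCube_mem X
    obtain ⟨γ', hγ', hcγ'⟩ := Finset.mem_biUnion.1 hc
    exact ⟨γ', hγ', cubeInc_of_mem hcγ' (Finset.mem_singleton_self _)⟩

/-- the polymers of the constructed geometry are the finite cube families (definitional). [folklore] -/
theorem geom_P : Γ.geom.P = Finset α := rfl

/-- the step volume of the constructed geometry (definitional). [folklore] -/
@[simp] theorem geom_vol (X : C.Dom) : Γ.geom.vol X = Γ.vol X := rfl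

/-- the localizing families of the constructed geometry (definitional). [folklore] -/
@[simp] theorem geom_clus (X : C.Dom) : Γ.geom.clus X = Γ.clus X := rfl

/-- the pin of the constructed geometry (definitional). [folklore] -/
@[simp] theorem geom_pin (X : C.Dom) : Γ.geom.pin X = ({Γ.pinCube X} : Finset α) := rfl

/-- the incompatibility of the constructed geometry (definitional). [folklore] -/
theorem geom_inc (Y Y' : Finset α) : Γ.geom.inc Y Y' = CubeInc adj Y Y' := rfl

/-- **THE CONSTRUCTED SUPPORT MAP** (`Supported`, v1.2 touch form) of the cube chart: `supp = id`, `region`, degree `≤ D`;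
the laws `sub`, `conn`, `inj`, `touch` are PROVED (touch ∘ `touch_of_cubeInc`). [cite: Balaban1988RG2Cluster, (2.11)-(2.13) p.14] -/
def supported : Supported Γ.geom α adj D where
  supp := fun γ => γ
  region := Γ.region
  deg := Γ.deg
  sub := fun _ _ hγ => (Γ.mem_vol.1 hγ).1
  conn := fun _ _ hγ => (Γ.mem_vol.1 hγ).2
  inj := fun _ _ _ _ _ h => h
  touch := fun _ _ hγ' _ hinc => touch_of_cubeInc (nonempty_of_mem_connFamilies hγ') hinc

/-- the support of a polymer is the polymer (definitional). [folklore] -/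
@[simp] theorem supported_supp (γ : Finset α) : Γ.supported.supp γ = γ := rfl

/-- the size weight of the constructed support map is `a₁·#cubes`. [folklore] -/
@[simp] theorem supported_sizeWeight (a₁ : ℝ) (γ : Finset α) :
    Γ.supported.sizeWeight a₁ γ = a₁ * (γ.card : ℝ) := rfl

/-! ## §4 The geometry binders PROVED: cover, pin size, comparability ⇒ `DecayExtract`, `PinBudget` -/

/-- **COVER (kernel)**: a localizing family of `X` covers exactly the cubes of `X`. [folklore] -/
theorem cover (X : C.Dom) (K : Finset (Finset α)) (hK : K ∈ Γ.geom.clus X) :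
    (Γ.cubes X).card ≤ (K.biUnion Γ.supported.supp).card := by
  obtain ⟨-, hU⟩ := Γ.mem_clus.1 hK
  have : K.biUnion Γ.supported.supp = K.biUnion id := rfl
  rw [this, hU]

/-- **PIN SIZE (kernel)**: the pin is one cube. [folklore] -/
theorem pin_card (X : C.Dom) : (Γ.supported.supp (Γ.geom.pin X)).card ≤ 1 := by
  simp

/-- **`DecayExtract` for the constructed geometry (kernel)**: the size weights `d₁·#cubes` extract `d₁·#cubes X`
(∘ `Supported.decayExtract_of_cover`). [folklore] -/
theorem decayExtract {d₁ : ℝ} (hd₁ : 0 ≤ d₁) :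
    Γ.geom.DecayExtract (fun X => d₁ * ((Γ.cubes X).card : ℝ)) (Γ.supported.sizeWeight d₁) :=
  Γ.supported.decayExtract_of_cover hd₁ Γ.cover

/-- **`PinBudget` for the constructed geometry (kernel)**: with `0 ≤ κ ≤ d₁`, `0 ≤ a₁` and the chart's `d(X) ≤ #cubes X`, the
size weights satisfy `PinBudget` with the CONSTANT envelope `a₁` (∘ `Supported.pinBudget_of_pinSize`, pin size `1`).
[cite: Balaban1988RG2Cluster, (2.30) p.18 and (2.40)-(2.41) p.21] -/
theorem pinBudget {a₁ d₁ κ : ℝ} (ha₁ : 0 ≤ a₁) (hκ : 0 ≤ κ) (hκd : κ ≤ d₁) :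
    Γ.geom.PinBudget (Γ.supported.sizeWeight a₁) (fun X => d₁ * ((Γ.cubes X).card : ℝ)) (fun _ => a₁) κ := by
  have hcmp : ∀ X, κ * C.d X ≤ d₁ * ((Γ.cubes X).card : ℝ) := fun X =>
    calc κ * C.d X ≤ κ * ((Γ.cubes X).card : ℝ) := mul_le_mul_of_nonneg_left (Γ.d_le X) hκ
      _ ≤ d₁ * ((Γ.cubes X).card : ℝ) := mul_le_mul_of_nonneg_right hκd (Nat.cast_nonneg _)
  have h := Γ.supported.pinBudget_of_pinSize (p₀ := 1) ha₁ Γ.pin_card hcmp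
  intro k X hX
  simpa using h k X hX

/-! ## §5 END-TO-END: NE9 ∧ FadingMemory on a cube chart — geometry discharged

Composition `T4HistoryLipschitzEntropy` §6 (`Supported.potentialKPG_of_avgEvalExpLinear_decay`) ∘ §4 ∘
`T4HistoryLipschitzActivity` §8c (`ClusterGeom.ne9_and_fadingMemory_of_potentialKPG_perStep`).  DISPLAYED (all NAMED binders
of the sibling leaves, unchanged): the recursion side — `ScaleZeroFree`, `AdmissibleTerms`, `AdmRestrict`,
`ChannelAdditive`, `ChannelStepSum`, `ChannelSizeAtStepNN` with geometric envelope `τ k j ≤ τbar·ω^{k−j}`, `Factorises`,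
`LastCouplingLipschitz` (NE9-LAST, printed qualitatively only), the read-out `ρ` of the previous terms into the table space
with its weighted-Lipschitz law and occupation bound `s₀ < R₀`; the activity side — averaged exp-EVALUATION activities with
integrable prefactors, measurable coefficients / evaluation points, `Σ‖c‖ ≤ l`, and (A) the DECAY of the configuration-free
majorant `∫‖pre‖e^{lR₀}dμ ≤ ε k·y^{#cubes}` on every step volume (NOT PRINTED uniformly over tables: GAPS G-ne9p2-5 (i));
(C) `y·e^{a₁+d₁}·e^{Dθ} ≤ θ`, `ε k·θ·(D+1) ≤ a₁`, `0 ≤ κ ≤ d₁`, `0 ≤ a₁`; and the cube chart (DATA).  GONE: hypothesis (B). -/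

section EndToEnd

open BoundedContinuousFunction

variable {Bg : Type} {Sp : Type*} [TopologicalSpace Sp] [MeasurableSpace Sp] [OpensMeasurableSpace Sp] {F : Type*}
  [Fintype F] {Ω : Type*} [MeasurableSpace Ω]

/-- **NE9 ∧ FADING MEMORY ON A CUBE CHART (kernel end-to-end; geometry constructed, not assumed).**  See the §5 header for
the displayed list; the moduli are the product moduli `ℓ·∏(ω + 4a₁τbar/(R₀ − s₀))` of the recursion leaf, fading when
`ω + 4a₁τbar/(R₀ − s₀) < 1`. [cite: Balaban1988RG2Cluster, (2.11)-(2.13) p.14, (2.30) p.18, Lemma 3 (2.38) p.20;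
KoteckyPreiss1986, (1)-(3)] -/
theorem ne9_and_fadingMemory_of_decay {ι : Type} {E : Functional C Bg} {W : Set (ℕ → ℝ)}
    {Adm : Set (Bg → C.Dom → ℝ)} {T : ℕ → (ℕ → ℝ) → (Bg → C.Dom → ℝ) → ι → ℝ}
    {Ψ : ℕ → ℝ → (ι → ℝ) → Bg → C.Dom → ℝ}
    {μ : ℕ → ℝ → Bg → Finset α → Measure Ω} {pre : ℕ → ℝ → Bg → Finset α → Ω → ℂ}
    {c : ℕ → ℝ → Bg → Finset α → Ω → F → ℂ} {pt : ℕ → ℝ → Bg → Finset α → Ω → F → Sp}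
    {l : ℕ → ℝ → Bg → Finset α → ℝ} {R₀ s₀ : ℝ} {ε : ℕ → ℝ} {y a₁ d₁ θ κ ℓ τbar ω : ℝ}
    {wt : ℕ → ι → ℝ} {τ : ℕ → ℕ → ℝ} {lam : ℕ → ℝ} (ρ : ℕ → (ι → ℝ) → (Sp →ᵇ ℂ))
    -- recursion side (displayed, named binders of the sibling leaves)
    (h0 : ScaleZeroFree E W) (hAdm : AdmissibleTerms E W Adm) (hres : AdmRestrict Adm)
    (hadd : ChannelAdditive Adm T) (hsum : ChannelStepSum Adm T) (hstep : ChannelSizeAtStepNN Adm T κ wt τ)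
    (hfac : Factorises E W T Ψ) (hlast : LastCouplingLipschitz E W T Ψ κ lam)
    (hρ : ∀ (k : ℕ) (P P' : ι → ℝ) (M : ℝ), (∀ y, |P y - P' y| ≤ wt k y * M) → ‖ρ k P - ρ k P'‖ ≤ M)
    (hΨ : ∀ (k : ℕ) (s : ℝ) (P P' : ι → ℝ) (U : Bg) (X : C.Dom),
      Ψ k s P U X - Ψ k s P' U X =
        (Γ.geom.newTerm (Γ.geom.avgExpLinearAct μ pre fun k s U γ ω => evalFunctional (c k s U γ ω) (pt k s U γ ω))
            k s U X (ρ k P) -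
          Γ.geom.newTerm (Γ.geom.avgExpLinearAct μ pre fun k s U γ ω => evalFunctional (c k s U γ ω) (pt k s U γ ω))
            k s U X (ρ k P')).re)
    (hocc : ∀ g ∈ W, ∀ g' ∈ W, ∀ k : ℕ, ‖ρ k (T k g' (E g))‖ ≤ s₀) (hsR : s₀ < R₀) (hR : 0 ≤ R₀)
    -- activity side: regularity data (discharged types) and (A) the decay of the configuration-free majorant (displayed)
    (hpre : ∀ k s U γ, Integrable (pre k s U γ) (μ k s U γ))
    (hc : ∀ k s U γ Y, AEStronglyMeasurable (fun ω => c k s U γ ω Y) (μ k s U γ))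
    (hpt : ∀ k s U γ Y, Measurable fun ω => pt k s U γ ω Y)
    (hl : ∀ k s U γ ω, ∑ Y, ‖c k s U γ ω Y‖ ≤ l k s U γ) (hε : ∀ k, 0 ≤ ε k) (hy : 0 ≤ y)
    (hdecay : ∀ g ∈ W, ∀ (k : ℕ) (U : Bg) (X : C.Dom), C.scale X = k + 1 → ∀ γ' ∈ Γ.vol X,
      Γ.geom.avgExpLinearMajorant μ pre l R₀ k (g k) U γ' ≤ ε k * y ^ γ'.card)
    -- (C) scalar smallness and the envelope data
    (hθ : y * Real.exp (a₁ + d₁) * Real.exp (D * θ) ≤ θ) (hεθ : ∀ k, ε k * θ * ((D : ℝ) + 1) ≤ a₁)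
    (ha₁ : 0 ≤ a₁) (hκ : 0 ≤ κ) (hκd : κ ≤ d₁) (hℓ : 0 ≤ ℓ) (hτbar : 0 ≤ τbar) (hω : 0 ≤ ω)
    (hpos : 0 < ω + 4 * a₁ / (R₀ - s₀) * τbar) (hlam : ∀ k, lam k ≤ ℓ)
    (hτ : ∀ k j, j ≤ k → 0 ≤ τ k j ∧ τ k j ≤ τbar * ω ^ (k - j)) :
    NE9 E W κ (prodModuli ℓ fun _ => ω + 4 * a₁ / (R₀ - s₀) * τbar) ∧
      FadingMemory (ℓ / (ω + 4 * a₁ / (R₀ - s₀) * τbar)) (ω + 4 * a₁ / (R₀ - s₀) * τbar)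
        (prodModuli ℓ fun _ => ω + 4 * a₁ / (R₀ - s₀) * τbar) := by
  have hd₁ : 0 ≤ d₁ := hκ.trans hκd
  have hKP := Γ.supported.potentialKPG_of_avgEvalExpLinear_decay (W := W) (μ := μ) (pre := pre) (c := c) (pt := pt)
    (l := l) (ε := ε) ha₁ hd₁ hR hpre hc hpt hl hε hy (fun g hg k U X hX γ' hγ' => hdecay g hg k U X hX γ' hγ') hθ hεθ
  exact Γ.geom.ne9_and_fadingMemory_of_potentialKPG_perStep ρ h0 hAdm hres hadd hsum hstep hfac hlast hKP
    (Γ.decayExtract hd₁) (Γ.pinBudget ha₁ hκ hκd) hsR hρ hΨ hocc hℓ ha₁ hτbar hω hpos hlam hτ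

end EndToEnd

end CubeChart

/-! ## §6 The intended site type at one scale: the discrete torus with the wall adjacency; a chart over it -/

section Torus

variable (ν N : ℕ)

/-- **WALL ADJACENCY ON THE DISCRETE TORUS** `Fin ν → ZMod N` of big cubes of one scale: `y = x ± e_i` for a coordinate
direction `i` (two cubes with a common wall, [I] p.257). [cite: Balaban1987RG1, p.257] -/
def torusAdj (x y : Fin ν → ZMod N) : Prop := ∃ i : Fin ν, y = x + Pi.single i 1 ∨ y = x - Pi.single i 1

/-- the wall adjacency is decidable. [folklore] -/
instance instDecidableRelTorusAdj : DecidableRel (torusAdj ν N) := fun x y => by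
  unfold torusAdj; infer_instance

/-- the wall adjacency is symmetric. [folklore] -/
instance instSymmTorusAdj : Std.Symm (torusAdj ν N) :=
  ⟨fun x y ⟨i, h⟩ => ⟨i, by
    rcases h with h | h
    · exact Or.inr (by rw [h, add_sub_cancel_right])
    · exact Or.inl (by rw [h, sub_add_cancel])⟩⟩

/-- **DEGREE OF THE WALL ADJACENCY** `≤ 2ν` (`= 8` on T⁴): the neighbours of `x` are among the `2ν` cubes `x ± e_i`.
[folklore] -/
theorem card_filter_torusAdj_le (x : Fin ν → ZMod N) (Q : Finset (Fin ν → ZMod N)) :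
    (Q.filter (torusAdj ν N x)).card ≤ 2 * ν := by
  classical
  let f : Fin ν × Bool → (Fin ν → ZMod N) := fun p => if p.2 then x + Pi.single p.1 1 else x - Pi.single p.1 1
  have hsub : Q.filter (torusAdj ν N x) ⊆ (Finset.univ : Finset (Fin ν × Bool)).image f := by
    intro y hy
    obtain ⟨-, i, h⟩ := Finset.mem_filter.1 hy
    rcases h with h | h
    · exact Finset.mem_image.2 ⟨(i, true), Finset.mem_univ _, by simp [f, h]⟩
    · exact Finset.mem_image.2 ⟨(i, false), Finset.mem_univ _, by simp [f, h]⟩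
  calc (Q.filter (torusAdj ν N x)).card ≤ ((Finset.univ : Finset (Fin ν × Bool)).image f).card := Finset.card_le_card hsub
    _ ≤ (Finset.univ : Finset (Fin ν × Bool)).card := Finset.card_image_le
    _ = 2 * ν := by simp [Finset.card_univ, mul_comm]

/-- The cross-read objection O1 to the v1 overlap reading, now ACCOMMODATED: two wall-adjacent one-cube families are
incompatible for `CubeInc (torusAdj ν N)` although their cube sets may be disjoint — and the touch form of `Supported` holds
for them by construction (`CubeChart.supported`). [folklore] -/
theorem cubeInc_wall (x : Fin ν → ZMod N) (i : Fin ν) : CubeInc (torusAdj ν N) {x} {x + Pi.single i 1} :=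
  Or.inr ⟨x, Finset.mem_singleton_self _, x + Pi.single i 1, Finset.mem_singleton_self _, Or.inr ⟨i, Or.inl rfl⟩⟩

/-- **TOY CARRIERS OVER THE TORUS** (non-vacuity of `CubeChart` only): domain indices = nonempty cube families of the torus
`Fin ν → ZMod (N+1)` paired with a scale, decay length `#cubes − 1` (the type of the upper half of (2.30)), trivial
backgrounds. [folklore] -/
def torusCarriers : Carriers where
  Dom := ℕ × {Y : Finset (Fin ν → ZMod (N + 1)) // Y.Nonempty}
  scale := fun X => X.1
  d := fun X => ((X.2.1.card : ℝ) - 1)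
  d_nonneg := fun X => by
    have h : 1 ≤ X.2.1.card := Finset.card_pos.2 X.2.2
    have h' : (1 : ℝ) ≤ (X.2.1.card : ℝ) := by exact_mod_cast h
    linarith
  BgA := Unit
  BgB := Unit
  gauge := fun _ _ => 0
  gauge_nonneg := fun _ _ => le_rfl
  transport := fun _ => ()

/-- **A CUBE CHART OVER THE TORUS CARRIERS** (non-vacuity of `CubeChart`): cubes = the family itself, region = the whole
torus, degree `2ν`, `d = #cubes − 1 ≤ #cubes`. [folklore] -/
def torusChart : CubeChart (torusCarriers ν N) (Fin ν → ZMod (N + 1)) (torusAdj ν (N + 1)) (2 * ν) where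
  cubes := fun X => X.2.1
  region := fun _ => Finset.univ
  cubes_sub := fun _ => Finset.subset_univ _
  cubes_nonempty := fun X => X.2.2
  deg := card_filter_torusAdj_le ν (N + 1)
  d_le := fun X => by
    show ((X.2.1.card : ℝ) - 1) ≤ (X.2.1.card : ℝ)
    linarith

/-- Non-vacuity of §3–§4 on the torus chart: the constructed geometry's `DecayExtract` and `PinBudget` hold with
`d₁ = κ = 1`, `a₁ = 1`. [folklore] -/
theorem torusChart_binders :
    (torusChart ν N).geom.DecayExtract (fun X => 1 * (((torusChart ν N).cubes X).card : ℝ))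
        ((torusChart ν N).supported.sizeWeight 1) ∧
      (torusChart ν N).geom.PinBudget ((torusChart ν N).supported.sizeWeight 1)
        (fun X => 1 * (((torusChart ν N).cubes X).card : ℝ)) (fun _ => 1) 1 :=
  ⟨(torusChart ν N).decayExtract zero_le_one, (torusChart ν N).pinBudget zero_le_one zero_le_one le_rfl⟩

end Torus

end Literature.MathematicalPhysics.QuantumFieldTheory.Balaban1983to89.T4HistoryLipschitzCubeGeometry

end
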